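import Summits.BirchSwinnertonDyer.BirchSwinnertonDyer.Theses.SchneiderFreeAdditiveX3
import Summits.BirchSwinnertonDyer.BirchSwinnertonDyer.Theorems.SchneiderFreeAdditiveX3JointLowerIdentity
import Summits.BirchSwinnertonDyer.BirchSwinnertonDyer.Theorems.SchneiderFreeAdditiveX3JointLowerTransport
import Literature.NumberTheory.EllipticCurves.Wuthrich2014.ShaBoundProofs
import HarnessLib

/-!
# Route `SchneiderFreeAdditiveX3` (rung K1 door, cell `bsd-schneider-ideate`): the crux `JointLowerManin` PROVED

Item `stmt-BirchSwinnertonDyer-19180` of route `route-BirchSwinnertonDyer-SchneiderFreeAdditiveX3`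
(`Theses/SchneiderFreeAdditiveX3.lean`, rev 3, crux, rank 9): from seven printed facts carried as
explicit antecedents — Gross–Zagier I.(6.3) (`gross_zagier`), Kolyvagin (`kolyvagin`), Gross–Zagier–
Kolyvagin over `ℚ` (`rank_eq_analyticRank_of_analyticRank_le_one`), modularity (`hasEntireLFunction_rat`),
a parametrisation datum (`nonempty_modularParametrizationData`), Cassels (`bsdRHS_eq_of_isIsogenous`) and
Gross–Zagier I.(7.3) (`GrossZagier1986_thm_I_7_3`) — the tree leaf `SchneiderFree.JointLowerOfStepLManin`:
for EVERY odd prime `p`, every Heegner/twist datum and ANY parametrisation datum `Dt` (NO condition on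
its constant `c`), STEP L over `K` at slack `v_p(c)`
(`2·ord_p[E(K):ℤP] ≤ ord_p #Ш(E/K) + 2·ord_p ∏c_ℓ(E) + 2·v_p(c)`) implies the JOINT lower half
`JointLowerBoundAt W Wd p` (`ord_p #Ш_an(E) + ord_p #Ш_an(E^{d_K}) ≤ ord_p #Ш(E) + ord_p #Ш(E^{d_K})`).

Proof (Jetchev–Skinner–Wan 2017 §7.4.1 with the parametrisation constant and the twist-model unit
CARRIED): the Manin-robust bookkeeping identity
`ord_p q + ord_p q_d + ord_p ∏c_ℓ(E) + 2 ord_p #E^{d_K}(ℚ)_tors + 2 v_p(c) + v_p(u) = 2 ord_p [E(K):ℤP]`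
(`exists_shaAn_padicVal_eq_of_heegner_manin`, helper 1), the twist's algebraic central value
`q_d = L(E^{d_K},1)/Ω ∈ ℚ` from Gross–Zagier I.(7.3) (`exists_rat_twist_L_one_div_realPeriod_of_heegner`),
Miller's `#Ш_an(E^{d_K}) = q_d · #E^{d_K}(ℚ)² / ∏c_ℓ(E^{d_K})` in rank `0`
(`Wuthrich2014.shaAn_eq_of_L_one_div_eq`), `Ш(E/K)[p^∞] ≅ Ш(E)[p^∞] ⊕ Ш(E^{d_K})[p^∞]`, and the two
INEQUALITIES that replace (eq:tamK) and `v_p(u) = 0` when neither `p ∣ N` nor `p ∤ d_K` is assumed: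
`ord_p ∏c_ℓ(E) ≤ ord_p ∏c_ℓ(E^{d_K})` (`padicValNat_tamagawaProduct_le_twist_of_heegner`) and
`0 ≤ v_p(u)` (`padicValRat_u_nonneg_of_twist_minimal_of_odd`) (helper 2). The `2·v_p(c)` CANCEL
(FINDING cacd1ba6 of the cell). Cassels' isogeny invariance and the parametrisation-datum fact are
antecedents of the item but are not needed. HONEST FRAMING: closes one crux of a DRAFT route; the rung
leaf `AdditiveX3RankOneLower` and BSD are NOT claimed.

References: [JetchevSkinnerWan2017] §7.4.1 (eq:gz for K′), (eq:shalowerK-1), (eq:tamK), pp. 29–31;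
[GrossZagier1986] Thms. I.(6.3), I.(7.3), V.§2; [Miller2011LMS] Def. 1.1;
[CesnaviciusNeururerSaha2020] arXiv:1911.09446 Thm. 1.2.
-/

noncomputable section

open scoped Classical

open WeierstrassCurve NumberField Literature.NumberTheory.EllipticCurves
  Literature.NumberTheory.EllipticCurves.ModularForms
  Literature.NumberTheory.EllipticCurves.Rank1Residual
  Literature.NumberTheory.EllipticCurves.Rank1Residual.Typed

namespace Summit.BirchSwinnertonDyer.BirchSwinnertonDyer.Theorems

/-- **Item `JointLowerManin` of route `SchneiderFreeAdditiveX3` holds**: the seven printed facts give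
the tree leaf `SchneiderFree.JointLowerOfStepLManin` — STEP L over the Heegner field at slack `v_p(c)`
implies the joint lower half `JointLowerBoundAt W Wd p`, for every odd `p`, with NO Manin hypothesis on
the parametrisation constant and for ANY globally minimal model of the twist (Jetchev–Skinner–Wan 2017
§7.4.1, Manin-robust: the constant and the twist-model unit are carried; `ord_p ∏c_ℓ(E) ≤
ord_p ∏c_ℓ(E^{d_K})` and `0 ≤ v_p(u)` replace (eq:tamK) and `v_p(u) = 0`).
[cite: JetchevSkinnerWan2017, §7.4.1 (eq:gz for K′)–(eq:shalowerK-1), pp. 29–31]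
[cite: GrossZagier1986, Thm. I.(7.3) 2) (p. 231)] [cite: Miller2011LMS, Def. 1.1] -/
theorem schneiderFreeAdditiveX3_jointLowerManin_proof :
    Summit.BirchSwinnertonDyer.BirchSwinnertonDyer.Theses.SchneiderFreeAdditiveX3.JointLowerManin := by
  intro hGZ hKo hGZK hmod _hmodD _hCas hGZ73 W _ _ p _ N _ K _ _ Dt H ι P Wd _ _ hr hN hK _hodd hw hHH hLd hP
    _hnt hC _hr0 hp2 hI
  obtain ⟨Cd, hWd⟩ := hC
  -- the twist's algebraic central value (Gross–Zagier I.(7.3))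
  obtain ⟨qd, hqd⟩ := SchneiderFree.exists_rat_twist_L_one_div_realPeriod_of_heegner W N K Dt H ι P
    (hGZ N W K) (hKo N W K) hGZK hmod hGZ73 hK hHH hP hr hLd Wd Cd hWd
  -- the Manin-robust bookkeeping identity
  obtain ⟨-, -, hsha, q, hq, hval⟩ := SchneiderFree.exists_shaAn_padicVal_eq_of_heegner_manin W p N K
    Dt H ι P (hGZ N W K) (hKo N W K) hGZK hmod hK hHH hP hp2 hw hr hLd Wd Cd hWd qd hqd
  -- `#Ш_an(E^{d_K})` in rank zero
  have hD0 : (NumberField.discr K : ℚ) ≠ 0 := by exact_mod_cast NumberField.discr_ne_zero K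
  haveI : (W.quadraticTwist (NumberField.discr K : ℚ)).IsElliptic := W.isElliptic_quadraticTwist hD0
  have hLd1 : Wd.entireLFunction 1 ≠ 0 := by rw [← hWd, entireLFunction_smul]; exact hLd
  obtain ⟨-, hfin, -, hshaAnd⟩ := Wuthrich2014.shaAn_eq_of_L_one_div_eq hGZK Wd hLd1 hqd
  haveI := hfin
  have htdeq : Wd.torsionOrder = Nat.card Wd.toAffine.Point := Wd.torsionOrder_eq_natCard_of_finite
  -- the two transports (inequalities)
  have hHN' : SatisfiesHeegnerHypothesis (W.conductorNorm ℤ) K := by rw [hN]; exact hHH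
  have htam := SchneiderFree.padicValNat_tamagawaProduct_le_twist_of_heegner W p K hK hHN' Cd hWd
  have hu := SchneiderFree.padicValRat_u_nonneg_of_twist_minimal_of_odd W p hp2 (NumberField.discr K)
    (NumberField.discr_ne_zero K) Cd hWd
  -- the joint lower half
  refine ⟨q, qd * (Nat.card Wd.toAffine.Point : ℚ) ^ 2 / (Wd.tamagawaProduct : ℚ), hq, hshaAnd, ?_⟩
  -- valuation of `#Ш_an(E^{d_K})`
  have hqd0 : qd ≠ 0 := by
    intro h0
    apply hLd1
    have hΩ : (Wd.realPeriodRat : ℂ) ≠ 0 := by exact_mod_cast Wd.realPeriodRat_pos_holds.ne'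
    rw [h0, Rat.cast_zero, div_eq_zero_iff] at hqd
    exact hqd.resolve_right hΩ
  have htd0 : (Nat.card Wd.toAffine.Point : ℚ) ≠ 0 := by exact_mod_cast (Nat.card_pos).ne'
  have hcd0 : (Wd.tamagawaProduct : ℚ) ≠ 0 := by exact_mod_cast Wd.tamagawaProduct_pos_holds.ne'
  have hvd : padicValRat p (qd * (Nat.card Wd.toAffine.Point : ℚ) ^ 2 / (Wd.tamagawaProduct : ℚ)) =
      padicValRat p qd + 2 * padicValNat p Wd.torsionOrder - padicValNat p Wd.tamagawaProduct := by
    rw [padicValRat.div (mul_ne_zero hqd0 (pow_ne_zero _ htd0)) hcd0, padicValRat.mul hqd0 (pow_ne_zero _ htd0),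
      padicValRat.pow, padicValRat.of_nat, padicValRat.of_nat, htdeq]
    push_cast; ring
  rw [hvd]
  -- STEP L at slack `v_p(c)` and the identity
  unfold SchneiderFree.IndexLowerBoundLeAt at hI
  have e1 : (2 * padicValNat p (AddSubgroup.zmultiples P).index : ℤ) ≤
      padicValNat p (W.baseChange K).shaOrder + 2 * padicValNat p W.tamagawaProduct +
        2 * padicValNat p Dt.c.natAbs := by exact_mod_cast hI
  have e2 : (padicValNat p (W.baseChange K).shaOrder : ℤ) =
      padicValNat p W.shaOrder + padicValNat p Wd.shaOrder := by exact_mod_cast hsha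
  have e3 : (padicValNat p W.tamagawaProduct : ℤ) ≤ padicValNat p Wd.tamagawaProduct := by
    exact_mod_cast htam
  linarith

end Summit.BirchSwinnertonDyer.BirchSwinnertonDyer.Theorems

end
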